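import Summits.ValiantsHypothesis.ValiantsHypothesis.Theorems.BarrierLeverSuccinctHittingSetsForVPIsobaricComponents
import Literature.Barriers.ValiantsHypothesis.FSV18UniversalConstructions
import Literature.Computability.AlgebraicComplexity.ValiantClasses

/-!
# Crux `BarrierLever.DefinableEquations` (stmt-ValiantsHypothesis-8745) / `SingleSizeEquations`
# (8749) — WEIGHT COMPONENTS OF BOOLEAN SUMS ARE BOOLEAN SUMS (Fourier extraction on the Boolean
# cube; toolkit for the isobaric normal form of boolean-sum equations)

The crux's witnesses are Valiant Boolean sums `E = boolSum H = Σ_{e ∈ {0,1}^q} H(c, e)` of level `a`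
(`q, L(H), deg H ≤ N^a`).  To put such an equation into normal form one needs that the class of
level-`O(a)` Boolean sums is closed under taking ISOBARIC (weighted homogeneous) components
`E ↦ E_J = weightedHomogeneousComponent W J E` for a weight `W : ι → ℕ` on the coefficient
variables — the coefficient-scale analogue of "VNP is closed under homogeneous components /
coefficient extraction" (Valiant's criterion circle of ideas, Bürgisser 2000 §2.1–2.3).  Plain
interpolation over `deg_W E + 1` points multiplies the size by the weighted degree, which for the
torus weights of the crux is `N^{Θ(a n)}` — useless.  The Boolean variables absorb the sum:

THEOREM (`exists_boolSum_eq_weightedHomogeneousComponent`).  `ι` finite, `W : ι → ℕ`,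
`H ∈ ℂ[ι ⊕ Fin q]`, `L J : ℕ` with `weightedTotalDegree W (boolSum H) < 2^L`.  There is
`H' ∈ ℂ[ι ⊕ Fin (q + L)]` with

  `boolSum H' = weightedHomogeneousComponent W J (boolSum H)`,
  `L(H') ≤ L(H) + |ι|·(3L+1) + 3L + 2`,  `deg H' ≤ deg H · (L+1) + L`.

Construction (`fourierWitness`): with `M = 2^L`, `ζ = exp(2πi/M)` and `L` fresh Boolean variables
`u`, the "twist" `tw(z) = Π_l (1 + u_l (z^{2^l} − 1))` evaluates at a Boolean point `u` to
`z^{k(u)}`, `k(u) = Σ_l u_l 2^l` running over `[0, M)` exactly once; put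
`H'(c, e, u) = M⁻¹ · tw(ζ^{-J}) · H((tw(ζ^{W m}) c_m)_m, e)`.  Summing over `u` gives
`M⁻¹ Σ_{k<M} ζ^{-Jk} E(ζ^{kW}·c) = Σ_j E_j(c) · M⁻¹ Σ_k ζ^{k(j−J)} = E_J(c)` (orthogonality of
characters of `ℤ/M`, as `Σ_u r^{k(u)} = Π_l (1 + r^{2^l})`, which is `M` at `r = 1` and `0` at any
other `M`-th root of unity).  ONE copy of `H` is used, so the level moves from `a` to `O(a)`.

Contents: §1 Boolean sums under substitutions of the `c`-variables and under splitting of the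
Boolean block (`boolSum_aeval_inl`, `boolSum_rename_blockEquiv`); §2 bit products and the twist
(`bitPow`, `twist`, `sum_bitPow_eq_prod`, `prod_one_add_pow_two_pow`); §3 torus scaling of weighted
components (`aeval_scale_eq_sum`); §4 the witness, its Boolean sum, size and degree.  Used by
`…DefinableEquationsIsobaric.lean` (WLOG the crux's witness is a weight vector of the torus).
No named facts; elementary.  References: [Burgisser2000] §2.1 (Valiant's model, Boolean sums),
Rem. 2.7 (substitution); [ForbesShpilkaVolk2018] Def. 1 (the frame).
-/

-- layout Summits/ValiantsHypothesis/ValiantsHypothesis forces the duplicated namespace component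
set_option linter.dupNamespace false

noncomputable section

open MvPolynomial

namespace Summit.ValiantsHypothesis.ValiantsHypothesis.Theorems.BarrierLever.BoolSumComponents

open Literature.Computability.AlgebraicComplexity
open Summit.ValiantsHypothesis.ValiantsHypothesis.Theorems.BarrierLever.SuccinctHittingSetsForVP

/-! ## §1 Boolean sums under substitutions and block splitting -/

section boolsum

variable {R : Type*} [CommSemiring R] {ι κ : Type*} {q L : ℕ}

/-- Evaluating a substitution: `eval P (aeval θ H) = eval (eval P ∘ θ) H`. [folklore] -/
theorem eval_aeval_eq {α β : Type*} (P : β → R) (θ : α → MvPolynomial β R) (H : MvPolynomial α R) :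
    eval P (aeval θ H) = eval (fun v => eval P (θ v)) H := by
  show eval₂Hom (RingHom.id R) P (bind₁ θ H) = _
  rw [eval₂Hom_bind₁]
  rfl

/-- Pointwise evaluation of a Boolean sum. [cite: Burgisser2000, §2.1] -/
theorem eval_boolSum (c : ι → R) (H : MvPolynomial (ι ⊕ Fin q) R) :
    eval c (boolSum H) = ∑ e : Fin q → Bool, eval (Sum.elim c fun j => if e j then 1 else 0) H := by
  unfold boolSum
  rw [map_sum]
  refine Finset.sum_congr rfl fun e _ => ?_
  rw [eval_aeval_eq]
  have hpt : (fun v => eval c (Sum.elim X (fun j => if e j then (1 : MvPolynomial ι R) else 0) v)) =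
      Sum.elim c (fun j => if e j then (1 : R) else 0) := by
    funext v
    rcases v with i | j
    · simp
    · simp only [Sum.elim_inr]
      split_ifs <;> simp
  rw [hpt]

/-- **Boolean sums commute with substitutions of the `c`-variables** by polynomials in new
`c`-variables (Boolean block untouched). [cite: Burgisser2000, Rem. 2.7] -/
theorem boolSum_aeval_inl (g : ι → MvPolynomial κ R) (H : MvPolynomial (ι ⊕ Fin q) R) :
    boolSum (aeval (Sum.elim (fun i => rename (Sum.inl : κ → κ ⊕ Fin q) (g i))
      (fun j => X (Sum.inr j))) H) = aeval g (boolSum H) := by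
  unfold boolSum
  rw [map_sum]
  refine Finset.sum_congr rfl fun e _ => ?_
  rw [← AlgHom.comp_apply, comp_aeval, ← AlgHom.comp_apply, comp_aeval]
  have hfun : (fun v => aeval (Sum.elim X fun j => if e j then (1 : MvPolynomial κ R) else 0)
        (Sum.elim (fun i => rename (Sum.inl : κ → κ ⊕ Fin q) (g i)) (fun j => X (Sum.inr j)) v)) =
      (fun v => aeval g (Sum.elim X (fun j => if e j then (1 : MvPolynomial ι R) else 0) v)) := by
    funext v
    rcases v with i | j
    · simp only [Sum.elim_inl, aeval_rename, aeval_X]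
      have : ((Sum.elim X fun j => if e j then (1 : MvPolynomial κ R) else 0) ∘
          (Sum.inl : κ → κ ⊕ Fin q)) = X := by funext x; rfl
      rw [this, aeval_X_left, AlgHom.coe_id, id_eq]
    · simp only [Sum.elim_inr, aeval_X]
      split_ifs <;> simp
  rw [hfun]

/-- The variables `(ι ⊕ Fin q) ⊕ Fin L` (coefficients, old Boolean block, new Boolean block) as
`ι ⊕ Fin (q + L)` (one Boolean block). [folklore] -/
def blockEquiv (ι : Type*) (q L : ℕ) : (ι ⊕ Fin q) ⊕ Fin L ≃ ι ⊕ Fin (q + L) :=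
  (Equiv.sumAssoc ι (Fin q) (Fin L)).trans (Equiv.sumCongr (Equiv.refl ι) finSumFinEquiv)

/-- Coefficient variables keep their index. [folklore] -/
@[simp] theorem blockEquiv_inl_inl (m : ι) :
    blockEquiv ι q L (Sum.inl (Sum.inl m)) = Sum.inl m := rfl

/-- Old Boolean variables go to the front of the merged block. [folklore] -/
@[simp] theorem blockEquiv_inl_inr (j : Fin q) :
    blockEquiv ι q L (Sum.inl (Sum.inr j)) = Sum.inr (Fin.castAdd L j) := rfl

/-- New Boolean variables go to the back of the merged block. [folklore] -/
@[simp] theorem blockEquiv_inr (l : Fin L) :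
    blockEquiv ι q L (Sum.inr l) = Sum.inr (Fin.natAdd q l) := rfl

/-- Setting the new Boolean block to a bit vector `u`. [folklore] -/
def setBits (u : Fin L → Bool) (G : MvPolynomial ((ι ⊕ Fin q) ⊕ Fin L) R) :
    MvPolynomial (ι ⊕ Fin q) R :=
  aeval (Sum.elim X fun l => if u l then (1 : MvPolynomial (ι ⊕ Fin q) R) else 0) G

/-- Splitting a Boolean point of `Fin (q + L)` into its two blocks. [folklore] -/
def splitBits (q L : ℕ) : (Fin (q + L) → Bool) ≃ (Fin q → Bool) × (Fin L → Bool) where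
  toFun E := (fun j => E (Fin.castAdd L j), fun l => E (Fin.natAdd q l))
  invFun p := Fin.append p.1 p.2
  left_inv E := Fin.append_castAdd_natAdd
  right_inv p := by
    ext j
    · exact Fin.append_left p.1 p.2 j
    · exact Fin.append_right p.1 p.2 _

/-- **Splitting the Boolean block**: the Boolean sum over `q + L` variables of (the re-indexing of)
`G` is the sum over the new bits `u` of the Boolean sums over the old block of `G|_{u}`.
[cite: Burgisser2000, §2.1] -/
theorem boolSum_rename_blockEquiv (G : MvPolynomial ((ι ⊕ Fin q) ⊕ Fin L) R) :
    boolSum (rename (blockEquiv ι q L) G) =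
      ∑ u : Fin L → Bool, boolSum (setBits u G) := by
  unfold boolSum
  -- re-index the outer sum along `splitBits`
  have hre : ∀ E : Fin (q + L) → Bool,
      aeval (Sum.elim X fun j => if E j then (1 : MvPolynomial ι R) else 0)
          (rename (blockEquiv ι q L) G) =
        aeval (Sum.elim X fun j => if (splitBits q L E).1 j then (1 : MvPolynomial ι R) else 0)
          (setBits (splitBits q L E).2 G) := by
    intro E
    rw [aeval_rename, setBits, ← AlgHom.comp_apply, comp_aeval]
    have hfun : ((Sum.elim X fun j => if E j then (1 : MvPolynomial ι R) else 0) ∘ (blockEquiv ι q L)) =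
        (fun v => aeval (Sum.elim X fun j => if (splitBits q L E).1 j then (1 : MvPolynomial ι R) else 0)
          (Sum.elim X (fun l => if (splitBits q L E).2 l then (1 : MvPolynomial (ι ⊕ Fin q) R) else 0)
            v)) := by
      funext v
      rcases v with (m | j) | l
      · simp [blockEquiv]
      · simp only [Function.comp_apply, blockEquiv_inl_inr, Sum.elim_inr, Sum.elim_inl, aeval_X]
        rfl
      · simp only [Function.comp_apply, blockEquiv_inr, Sum.elim_inr]
        show (if E (Fin.natAdd q l) then (1 : MvPolynomial ι R) else 0) =
          aeval _ (if E (Fin.natAdd q l) then (1 : MvPolynomial (ι ⊕ Fin q) R) else 0)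
        split_ifs <;> simp
    rw [hfun]
  simp_rw [hre]
  rw [← (splitBits q L).symm.sum_comp, Fintype.sum_prod_type, Finset.sum_comm]
  refine Finset.sum_congr rfl fun u _ => Finset.sum_congr rfl fun e _ => ?_
  rw [Equiv.apply_symm_apply]

end boolsum

/-! ## §2 Bit products, their orthogonality, and the twist polynomial -/

section bits

variable {R : Type*} [CommRing R] {L : ℕ}

/-- `r^{k(u)}` written bitwise, `k(u) = Σ_l u_l 2^l`: the product `Π_l (u_l ? r^{2^l} : 1)`. [folklore] -/
def bitPow (u : Fin L → Bool) (r : R) : R := ∏ l : Fin L, if u l then r ^ 2 ^ (l : ℕ) else 1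

/-- `bitPow u` is multiplicative in the base. [folklore] -/
theorem bitPow_mul (u : Fin L → Bool) (r s : R) : bitPow u (r * s) = bitPow u r * bitPow u s := by
  unfold bitPow
  rw [← Finset.prod_mul_distrib]
  refine Finset.prod_congr rfl fun l _ => ?_
  split_ifs <;> simp [mul_pow]

/-- `bitPow u (r^a) = (bitPow u r)^a`. [folklore] -/
theorem bitPow_pow (u : Fin L → Bool) (r : R) (a : ℕ) : bitPow u (r ^ a) = bitPow u r ^ a := by
  unfold bitPow
  rw [← Finset.prod_pow]
  refine Finset.prod_congr rfl fun l _ => ?_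
  split_ifs
  · rw [← pow_mul, ← pow_mul, mul_comm]
  · rw [one_pow]

/-- `Σ_u r^{k(u)} = Π_l (1 + r^{2^l})`. [folklore] -/
theorem sum_bitPow_eq_prod (r : R) :
    ∑ u : Fin L → Bool, bitPow u r = ∏ l : Fin L, (1 + r ^ 2 ^ (l : ℕ)) := by
  unfold bitPow
  rw [← Fintype.prod_sum fun (l : Fin L) (b : Bool) => if b then r ^ 2 ^ (l : ℕ) else (1 : R)]
  refine Finset.prod_congr rfl fun l _ => ?_
  rw [Fintype.sum_bool]
  simp [add_comm]

/-- Telescoping: `(Π_{l<L} (1 + r^{2^l})) (r − 1) = r^{2^L} − 1`. [folklore] -/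
theorem prod_one_add_pow_two_pow_mul (r : R) :
    ∀ L : ℕ, (∏ l : Fin L, (1 + r ^ 2 ^ (l : ℕ))) * (r - 1) = r ^ 2 ^ L - 1
  | 0 => by simp
  | L + 1 => by
    rw [Fin.prod_univ_castSucc]
    simp only [Fin.val_castSucc, Fin.val_last]
    calc (∏ l : Fin L, (1 + r ^ 2 ^ (l : ℕ))) * (1 + r ^ 2 ^ L) * (r - 1)
        = ((∏ l : Fin L, (1 + r ^ 2 ^ (l : ℕ))) * (r - 1)) * (1 + r ^ 2 ^ L) := by ring
      _ = (r ^ 2 ^ L - 1) * (1 + r ^ 2 ^ L) := by rw [prod_one_add_pow_two_pow_mul r L]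
      _ = r ^ 2 ^ (L + 1) - 1 := by rw [pow_succ, pow_mul]; ring

/-- **Orthogonality of the characters of `ℤ/2^L`, trivial character**: `Σ_u 1^{k(u)} = 2^L`.
[folklore] -/
theorem sum_bitPow_one : ∑ u : Fin L → Bool, bitPow u (1 : R) = 2 ^ L := by
  rw [sum_bitPow_eq_prod]
  simp only [one_pow]
  rw [Finset.prod_const, Finset.card_univ, Fintype.card_fin]
  norm_num

/-- **Orthogonality of the characters of `ℤ/2^L`, nontrivial character**: for a `2^L`-th root of
unity `r ≠ 1` in a domain, `Σ_u r^{k(u)} = 0`. [folklore] -/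
theorem sum_bitPow_eq_zero [IsDomain R] {r : R} (hr : r ^ 2 ^ L = 1) (h1 : r ≠ 1) :
    ∑ u : Fin L → Bool, bitPow u r = 0 := by
  rw [sum_bitPow_eq_prod]
  have key := prod_one_add_pow_two_pow_mul r L
  rw [hr, sub_self] at key
  exact (mul_eq_zero.1 key).resolve_right (sub_ne_zero.2 h1)

variable {ι : Type*} {q : ℕ}

/-- **The twist** `tw(z) = Π_l (1 + u_l (z^{2^l} − 1))` in the new Boolean variables `u_l`
(a polynomial of size `≤ 3L` and degree `≤ L`); at a Boolean point `u` it evaluates to `z^{k(u)}`.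
[folklore] -/
def twist (z : R) : MvPolynomial ((ι ⊕ Fin q) ⊕ Fin L) R :=
  ∏ l : Fin L, (1 + X (Sum.inr l) * C (z ^ 2 ^ (l : ℕ) - 1))

/-- At a Boolean point `u` the twist is the constant `bitPow u z = z^{k(u)}`. [folklore] -/
theorem setBits_twist (u : Fin L → Bool) (z : R) :
    setBits u (twist (ι := ι) (q := q) z) = C (bitPow u z) := by
  unfold setBits twist bitPow
  rw [map_prod, map_prod]
  refine Finset.prod_congr rfl fun l _ => ?_
  rw [map_add, map_one, map_mul, aeval_X, aeval_C, algebraMap_eq, Sum.elim_inr]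
  split_ifs
  · rw [one_mul, map_sub, map_one, add_sub_cancel]
  · rw [zero_mul, add_zero, map_one]

/-- The twist has size `≤ 3L`. [cite: Burgisser2000, §2.1] -/
theorem complexity_twist_le (z : R) : complexity (twist (ι := ι) (q := q) (L := L) z) ≤ 3 * L := by
  unfold twist
  refine (complexity_finset_prod_le _ _).trans ?_
  rw [Finset.card_univ, Fintype.card_fin]
  have h : ∀ l : Fin L, complexity (1 + X (Sum.inr l) * C (z ^ 2 ^ (l : ℕ) - 1) :
      MvPolynomial ((ι ⊕ Fin q) ⊕ Fin L) R) ≤ 2 := fun l => by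
    calc complexity (1 + X (Sum.inr l) * C (z ^ 2 ^ (l : ℕ) - 1) :
          MvPolynomial ((ι ⊕ Fin q) ⊕ Fin L) R)
        ≤ complexity (1 : MvPolynomial ((ι ⊕ Fin q) ⊕ Fin L) R) +
            complexity (X (Sum.inr l) * C (z ^ 2 ^ (l : ℕ) - 1) :
              MvPolynomial ((ι ⊕ Fin q) ⊕ Fin L) R) + 1 := complexity_add_le_holds _ _
      _ ≤ 0 + (0 + 0 + 1) + 1 := by
          refine Nat.add_le_add_right (Nat.add_le_add ?_ ((complexity_mul_le_holds _ _).trans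
            (Nat.add_le_add_right (Nat.add_le_add (complexity_X_holds _).le
              (complexity_C_holds _).le) 1))) 1
          rw [← C_1]; exact (complexity_C_holds _).le
      _ = 2 := by norm_num
  calc ∑ l : Fin L, complexity (1 + X (Sum.inr l) * C (z ^ 2 ^ (l : ℕ) - 1) :
        MvPolynomial ((ι ⊕ Fin q) ⊕ Fin L) R) + L
      ≤ ∑ _l : Fin L, 2 + L := Nat.add_le_add_right (Finset.sum_le_sum fun l _ => h l) _
    _ = 3 * L := by rw [Finset.sum_const, Finset.card_univ, Fintype.card_fin, smul_eq_mul]; ring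

/-- The twist has degree `≤ L`. [folklore] -/
theorem totalDegree_twist_le [Nontrivial R] (z : R) :
    (twist (ι := ι) (q := q) (L := L) z).totalDegree ≤ L := by
  unfold twist
  refine (totalDegree_finsetProd _ _).trans ?_
  calc ∑ l : Fin L, (1 + X (Sum.inr l) * C (z ^ 2 ^ (l : ℕ) - 1) :
        MvPolynomial ((ι ⊕ Fin q) ⊕ Fin L) R).totalDegree
      ≤ ∑ _l : Fin L, 1 := Finset.sum_le_sum fun l _ => by
        refine (totalDegree_add _ _).trans (max_le ?_ ?_)
        · rw [totalDegree_one]; exact Nat.zero_le _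
        · refine (totalDegree_mul _ _).trans ?_
          rw [totalDegree_X, totalDegree_C, add_zero]
    _ = L := by simp

end bits

/-! ## §3 Torus scaling of weighted components -/

section torus

variable {ι : Type*} (W : ι → ℕ)

/-- A `W`-isobaric polynomial of weight `j` scales by `s^j` under `c_m ↦ s^{W m} c_m`
(polynomial identity over `ℂ`). [folklore] -/
theorem aeval_scale_of_isWeightedHomogeneous (s : ℂ) {φ : MvPolynomial ι ℂ} {j : ℕ}
    (hφ : IsWeightedHomogeneous W φ j) :
    aeval (fun m => C (s ^ W m) * X m) φ = C (s ^ j) * φ := by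
  refine MvPolynomial.funext fun c => ?_
  rw [eval_aeval_eq, map_mul, eval_C]
  have hpt : (fun m => eval c (C (s ^ W m) * X m)) = fun m => s ^ W m * c m := by
    funext m; rw [map_mul, eval_C, eval_X]
  rw [hpt]
  exact Isobaric.eval_torus_of_isWeightedHomogeneous W c s hφ

/-- **Torus scaling resolves the isobaric components**:
`E(s^W · c) = Σ_{j ≤ deg_W E} s^j E_j(c)` as polynomials. [folklore] -/
theorem aeval_scale_eq_sum (s : ℂ) (E : MvPolynomial ι ℂ) :
    aeval (fun m => C (s ^ W m) * X m) E =
      ∑ j ∈ Finset.range (weightedTotalDegree W E + 1),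
        C (s ^ j) * weightedHomogeneousComponent W j E := by
  conv_lhs => rw [← Isobaric.sum_weightedHomogeneousComponent_range W E (weightedTotalDegree W E)
    (fun d hd => le_weightedTotalDegree W hd)]
  rw [map_sum]
  exact Finset.sum_congr rfl fun j _ => aeval_scale_of_isWeightedHomogeneous W s
    (weightedHomogeneousComponent_isWeightedHomogeneous j E)

end torus

end Summit.ValiantsHypothesis.ValiantsHypothesis.Theorems.BarrierLever.BoolSumComponents

end
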